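import Summits.AnomalousDissipation.AnomalousDissipation.Theses.LoudWindows
import Literature.Analysis.FluidPDE.CylindricalTrajectory
import Literature.Analysis.FluidPDE.LongTimeAverageNonneg
import HarnessLib

/-!
# Route LoudWindows — support `WeakDuality`, part 2: the cylindrical chain rule along a Leray–Hopf path

Function-level twin of `Torus.IsGlobalLerayHopf.cylindrical_eval_sub_eq_integral`: no `H`-lift is
needed (Leray–Hopf data on `T^d` need not be mean zero), the coordinates being the raw pairings
`cᵢ(t) = ∫⟪u(t), gᵢ⟫`. For a cylindrical test functional `Φ = φ(c₁, …, c_m)`, `0 < a ≤ b`: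
`φ(c(b)) − φ(c(a)) = ∫ₐᵇ Σᵢ ∂ᵢφ(c(t)) fluxᵢ(t) dt` with `fluxᵢ = Torus.trajFlux ν f u gᵢ` (time-sliced
weak formulation, absolute continuity, Lebesgue differentiation, FTC); the integrand is integrable
on every `(0, T]` and, `φ` being bounded, its Cesàro means tend to `0`.

Decomposition cell `decomp-ad`, lens-3 lineage g61 (route LoudWindows, item
stmt-AnomalousDissipation-28927).

[folklore] [cite: FoiasManleyRosaTemam2001, App. B.2 (B.18)–(B.19)]
-/

noncomputable section

open MeasureTheory Filter Topology Set UnitAddTorus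
open scoped ENNReal NNReal RealInnerProductSpace

namespace Summit.AnomalousDissipation.AnomalousDissipation.Theorems

open Literature.Analysis.FluidPDE Literature.Analysis.FunctionSpaces

set_option linter.dupNamespace false

variable {d : Type*} [Fintype d] [DecidableEq d]

variable {ν : ℝ} {f u₀ : UnitAddTorus d → EuclideanSpace ℝ d} {u : ℝ → UnitAddTorus d → EuclideanSpace ℝ d}

omit [Fintype d] [DecidableEq d] in
/-- A Lipschitz function of an absolutely continuous curve is absolutely continuous. [folklore] -/
theorem weakDuality_lipschitz_comp_ac {X Y : Type*} [PseudoMetricSpace X]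
    [PseudoMetricSpace Y] {φ : X → Y} {K : ℝ≥0} (hφ : LipschitzWith K φ) {γ : ℝ → X} {a b : ℝ}
    (hγ : AbsolutelyContinuousOnInterval γ a b) : AbsolutelyContinuousOnInterval (φ ∘ γ) a b := by
  unfold AbsolutelyContinuousOnInterval at hγ ⊢
  have h := hγ.const_mul (K : ℝ)
  rw [mul_zero] at h
  refine squeeze_zero (fun E => Finset.sum_nonneg fun i _ => dist_nonneg) (fun E => ?_) h
  rw [Finset.mul_sum]
  exact Finset.sum_le_sum fun i _ => hφ.dist_le_mul _ _

/-- **Coordinates along the path are primitives of the fluxes**: for a global Leray–Hopf solution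
with steady `L²` force, a smooth divergence-free `g` and `0 < a ≤ t`,
`∫⟪u(t), g⟫ = ∫⟪u(a), g⟫ + ∫ₐᵗ flux_g` (time-sliced weak formulation). [folklore] -/
theorem weakDuality_pairing_eq_add_integral_trajFlux (hf : MemLp f 2 volume)
    (hu : Torus.IsGlobalLerayHopf ν (fun _ => f) u₀ u) {g : UnitAddTorus d → EuclideanSpace ℝ d}
    (hg : Torus.IsSmooth g) (hgdiv : Torus.IsDivFree g) {a t : ℝ} (ha : 0 < a) (hat : a ≤ t) :
    ∫ x, ⟪u t x, g x⟫ = (∫ x, ⟪u a x, g x⟫) + ∫ s in a..t, Torus.trajFlux ν f u g s := by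
  have h := (hu t (ha.trans_le hat)).integral_inner_sub_eq_setIntegral (ha.trans_le hat)
    (Torus.aestronglyMeasurable_stLift_steady' hf.1 _) (Torus.lintegral_enorm_sq_steady_lt_top hf t)
    hg hgdiv ha hat le_rfl
  rw [intervalIntegral.integral_of_le hat]
  unfold Torus.trajFlux
  linarith

/-- **The cylindrical chain rule along a Leray–Hopf path** (function level): for `0 < a ≤ b`,
`φ(c(b)) − φ(c(a)) = ∫ₐᵇ Σᵢ ∂ᵢφ(c(t))·fluxᵢ(t) dt`, `cᵢ(t) = ∫⟪u(t), gᵢ⟫`.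
[cite: FoiasManleyRosaTemam2001, App. B.2 (B.18)–(B.19)] -/
theorem weakDuality_chainRule (hf : MemLp f 2 volume)
    (hu : Torus.IsGlobalLerayHopf ν (fun _ => f) u₀ u) (Φ : Torus.CylindricalTest d) {a b : ℝ}
    (ha : 0 < a) (hab : a ≤ b) :
    Φ.φ (WithLp.toLp 2 fun i => ∫ x, ⟪u b x, Φ.g i x⟫) -
        Φ.φ (WithLp.toLp 2 fun i => ∫ x, ⟪u a x, Φ.g i x⟫) =
      ∫ t in a..b, ∑ i, fderiv ℝ Φ.φ (WithLp.toLp 2 fun i' => ∫ x, ⟪u t x, Φ.g i' x⟫)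
        (EuclideanSpace.single i 1) * Torus.trajFlux ν f u (Φ.g i) t := by
  -- coordinates, fluxes and primitives
  set c : ℝ → EuclideanSpace ℝ (Fin Φ.m) := fun t => WithLp.toLp 2 fun i => ∫ x, ⟪u t x, Φ.g i x⟫
    with hc
  set fl : Fin Φ.m → ℝ → ℝ := fun i => Torus.trajFlux ν f u (Φ.g i) with hfl
  have hfl_int : ∀ i, IntervalIntegrable (fl i) volume a b := fun i =>
    hu.intervalIntegrable_trajFlux hf (Φ.g_smooth i) ha.le hab
  set G : Fin Φ.m → ℝ → ℝ := fun i t => ∫ s in a..t, fl i s with hG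
  have hcoord : ∀ i, ∀ t ∈ Icc a b, c t i = c a i + G i t := by
    intro i t ht
    show (∫ x, ⟪u t x, Φ.g i x⟫) = (∫ x, ⟪u a x, Φ.g i x⟫) + ∫ s in a..t, fl i s
    exact weakDuality_pairing_eq_add_integral_trajFlux hf hu (Φ.g_smooth i) (Φ.g_divFree i) ha ht.1
  -- the curve rebuilt from the primitives
  set γ : ℝ → EuclideanSpace ℝ (Fin Φ.m) := fun t =>
    c a + ∑ i, G i t • EuclideanSpace.single i (1 : ℝ) with hγ
  have hγ_eq : ∀ t ∈ Icc a b, γ t = c t := by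
    intro t ht
    have e1 := Torus.eq_sum_coord_smul_single (c t)
    have e2 := Torus.eq_sum_coord_smul_single (c a)
    rw [e1, hγ]
    dsimp only
    conv_lhs => rw [e2]
    rw [← Finset.sum_add_distrib]
    refine Finset.sum_congr rfl fun i _ => ?_
    rw [hcoord i t ht, add_smul]
  set h : ℝ → ℝ := fun t => Φ.φ (γ t) with hh
  -- `h` is absolutely continuous on `[a, b]`
  obtain ⟨K, hK⟩ := Φ.lipschitzWith
  have hGac : ∀ i, AbsolutelyContinuousOnInterval (G i) a b := fun i =>
    (hfl_int i).absolutelyContinuousOnInterval_intervalIntegral left_mem_uIcc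
  have hγac : AbsolutelyContinuousOnInterval γ a b := by
    unfold AbsolutelyContinuousOnInterval at hGac ⊢
    have hsum := tendsto_finsetSum Finset.univ fun i (_ : i ∈ Finset.univ) => hGac i
    rw [Finset.sum_const_zero] at hsum
    refine squeeze_zero (fun E => Finset.sum_nonneg fun j _ => dist_nonneg) (fun E => ?_) hsum
    rw [Finset.sum_comm]
    refine Finset.sum_le_sum fun j _ => ?_
    rw [dist_eq_norm]
    have hsub : γ (E.2 j).1 - γ (E.2 j).2 =
        ∑ i, (G i (E.2 j).1 - G i (E.2 j).2) • EuclideanSpace.single i (1 : ℝ) := by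
      simp only [hγ, add_sub_add_left_eq_sub, ← Finset.sum_sub_distrib, sub_smul]
    rw [hsub]
    refine (Torus.norm_sum_smul_single_le _).trans (le_of_eq (Finset.sum_congr rfl fun i _ => ?_))
    rw [Real.dist_eq]
  have hac : AbsolutelyContinuousOnInterval h a b := weakDuality_lipschitz_comp_ac hK hγac
  -- the a.e. derivative of `h`
  have hae : ∀ᵐ t, t ∈ uIcc a b → ∀ i, HasDerivAt (G i) (fl i t) t := by
    have hi : ∀ i, ∀ᵐ t, t ∈ uIcc a b → HasDerivAt (G i) (fl i t) t := fun i =>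
      ((hfl_int i).ae_hasDerivAt_integral).mono fun t ht hmem => ht hmem a left_mem_uIcc
    exact (eventually_all.2 hi).mono fun t ht hmem i => ht i hmem
  have hderiv : ∀ᵐ t, t ∈ uIcc a b →
      HasDerivAt h (∑ i, fl i t * fderiv ℝ Φ.φ (γ t) (EuclideanSpace.single i 1)) t := by
    filter_upwards [hae] with t ht hmem
    have hγ' : HasDerivAt γ (∑ i, fl i t • EuclideanSpace.single i (1 : ℝ)) t := by
      have hs := HasDerivAt.fun_sum (u := Finset.univ)
        fun i (_ : i ∈ Finset.univ) => (ht hmem i).smul_const (EuclideanSpace.single i (1 : ℝ))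
      have hs' := hs.const_add (c a)
      rw [hγ]
      exact hs'
    have hφ' : HasFDerivAt Φ.φ (fderiv ℝ Φ.φ (γ t)) (γ t) :=
      ((Φ.φ_contDiff.differentiable one_ne_zero) _).hasFDerivAt
    have hcomp := hφ'.comp_hasDerivAt t hγ'
    have hval : fderiv ℝ Φ.φ (γ t) (∑ i, fl i t • EuclideanSpace.single i (1 : ℝ)) =
        ∑ i, fl i t * fderiv ℝ Φ.φ (γ t) (EuclideanSpace.single i 1) := by
      rw [map_sum]
      exact Finset.sum_congr rfl fun i _ => by rw [map_smul, smul_eq_mul]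
    rw [← hval]
    exact hcomp
  -- the fundamental theorem of calculus for the absolutely continuous `h`
  have hFTC := hac.integral_deriv_eq_sub
  have hderiv_eq : ∀ᵐ t, t ∈ Set.uIoc a b → deriv h t =
      ∑ i, fderiv ℝ Φ.φ (c t) (EuclideanSpace.single i 1) * fl i t := by
    filter_upwards [hderiv] with t ht hmem
    rw [uIoc_of_le hab] at hmem
    have hmem' : t ∈ Icc a b := ⟨hmem.1.le, hmem.2⟩
    have hmem'' : t ∈ uIcc a b := by rw [uIcc_of_le hab]; exact hmem'
    rw [(ht hmem'').deriv, hγ_eq t hmem']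
    exact Finset.sum_congr rfl fun i _ => mul_comm _ _
  have hb : h b = Φ.φ (c b) := by
    show Φ.φ (γ b) = Φ.φ (c b)
    rw [hγ_eq b ⟨hab, le_rfl⟩]
  have ha' : h a = Φ.φ (c a) := by
    show Φ.φ (γ a) = Φ.φ (c a)
    rw [hγ_eq a ⟨le_rfl, hab⟩]
  rw [← hb, ← ha', ← hFTC]
  exact intervalIntegral.integral_congr_ae hderiv_eq

/-- The coordinates `t ↦ (∫⟪u(t), gᵢ⟫)ᵢ` are continuous on `(0, T]` (weak `L²`-continuity of
Leray–Hopf solutions). [folklore] -/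
theorem weakDuality_continuousOn_coords (hu : Torus.IsGlobalLerayHopf ν (fun _ => f) u₀ u)
    (Φ : Torus.CylindricalTest d) {T : ℝ} (hT : 0 < T) :
    ContinuousOn (fun t => (WithLp.toLp 2 fun i => ∫ x, ⟪u t x, Φ.g i x⟫ : EuclideanSpace ℝ (Fin Φ.m)))
      (Ioc 0 T) := by
  refine (PiLp.continuous_toLp 2 _).comp_continuousOn ?_
  exact continuousOn_pi.2 fun i => ((hu T hT).weak_continuous (Φ.g i) ((Φ.g_smooth i).memLp 2)).1

/-- **Integrability of the chain-rule integrand** `Σᵢ ∂ᵢφ(c(t)) fluxᵢ(t)` on `(0, T]`: bounded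
continuous coefficients (`φ ∈ C¹_c`) times integrable fluxes. [folklore] -/
theorem weakDuality_integrableOn_chain (hf : MemLp f 2 volume)
    (hu : Torus.IsGlobalLerayHopf ν (fun _ => f) u₀ u) (Φ : Torus.CylindricalTest d) {T : ℝ}
    (hT : 0 < T) :
    IntegrableOn (fun t => ∑ i, fderiv ℝ Φ.φ (WithLp.toLp 2 fun i' => ∫ x, ⟪u t x, Φ.g i' x⟫)
        (EuclideanSpace.single i 1) * Torus.trajFlux ν f u (Φ.g i) t) (Ioc 0 T) := by
  obtain ⟨M, hM⟩ := (Φ.φ_contDiff.continuous_fderiv one_ne_zero).bounded_above_of_compact_support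
    (Φ.φ_compact.fderiv (𝕜 := ℝ))
  refine integrable_finsetSum _ fun i _ => ?_
  have hfl : IntegrableOn (Torus.trajFlux ν f u (Φ.g i)) (Ioc 0 T) :=
    (integrableOn_Ioc_iff_integrableOn_Ioo (by finiteness)).2
      (hu.integrableOn_trajFlux hf (Φ.g_smooth i) hT)
  have hφc : Continuous fun z : EuclideanSpace ℝ (Fin Φ.m) =>
      fderiv ℝ Φ.φ z (EuclideanSpace.single i 1) :=
    (Φ.φ_contDiff.continuous_fderiv one_ne_zero).clm_apply continuous_const
  have hmeas : AEStronglyMeasurable (fun t => fderiv ℝ Φ.φ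
      (WithLp.toLp 2 fun i' => ∫ x, ⟪u t x, Φ.g i' x⟫) (EuclideanSpace.single i 1))
      (volume.restrict (Ioc 0 T)) :=
    (hφc.comp_continuousOn (weakDuality_continuousOn_coords hu Φ hT)).aestronglyMeasurable
      measurableSet_Ioc
  refine hfl.bdd_mul (c := M) hmeas (ae_of_all _ fun t => ?_)
  calc ‖fderiv ℝ Φ.φ (WithLp.toLp 2 fun i' => ∫ x, ⟪u t x, Φ.g i' x⟫) (EuclideanSpace.single i 1)‖
      ≤ ‖fderiv ℝ Φ.φ (WithLp.toLp 2 fun i' => ∫ x, ⟪u t x, Φ.g i' x⟫)‖ *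
          ‖(EuclideanSpace.single i (1 : ℝ) : EuclideanSpace ℝ (Fin Φ.m))‖ :=
        ContinuousLinearMap.le_opNorm _ _
    _ ≤ M * 1 := by
        refine mul_le_mul (hM _) ?_ (norm_nonneg _) ((norm_nonneg _).trans (hM 0))
        rw [EuclideanSpace.single, PiLp.norm_single, norm_one]
    _ = M := mul_one M

/-- **The Cesàro means of the chain-rule integrand vanish**: `T⁻¹∫₀ᵀ Σᵢ ∂ᵢφ(c)fluxᵢ → 0`, since
`∫₁ᵀ = φ(c(T)) − φ(c(1))` and `φ` is bounded. [cite: FoiasManleyRosaTemam2001, App. B.2 (B.20)] -/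
theorem weakDuality_tendsto_timeMean_chain (hf : MemLp f 2 volume)
    (hu : Torus.IsGlobalLerayHopf ν (fun _ => f) u₀ u) (Φ : Torus.CylindricalTest d) :
    Tendsto (timeMean fun t => ∑ i, fderiv ℝ Φ.φ (WithLp.toLp 2 fun i' => ∫ x, ⟪u t x, Φ.g i' x⟫)
        (EuclideanSpace.single i 1) * Torus.trajFlux ν f u (Φ.g i) t) atTop (𝓝 0) := by
  set Gs : ℝ → ℝ := fun t => ∑ i, fderiv ℝ Φ.φ (WithLp.toLp 2 fun i' => ∫ x, ⟪u t x, Φ.g i' x⟫)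
        (EuclideanSpace.single i 1) * Torus.trajFlux ν f u (Φ.g i) t with hGs
  obtain ⟨M₀, hM₀⟩ := Φ.φ_contDiff.continuous.bounded_above_of_compact_support Φ.φ_compact
  set I₁ : ℝ := ∫ t in (0 : ℝ)..1, Gs t with hI₁
  have hint : ∀ {a b : ℝ}, 0 ≤ a → a ≤ b → 0 < b → IntervalIntegrable Gs volume a b := by
    intro a b ha hab hb
    rw [intervalIntegrable_iff_integrableOn_Ioc_of_le hab]
    exact (weakDuality_integrableOn_chain hf hu Φ hb).mono_set (Ioc_subset_Ioc_left ha)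
  -- the bound `|⟨Gs⟩_T| ≤ (|I₁| + 2 M₀) T⁻¹` for `T ≥ 1`
  have hbound : ∀ T, 1 ≤ T → |timeMean Gs T| ≤ (|I₁| + (M₀ + M₀)) * T⁻¹ := by
    intro T hT
    have hT0 : 0 < T := by linarith
    have hsplit : ∫ t in (0 : ℝ)..T, Gs t = I₁ + ∫ t in (1 : ℝ)..T, Gs t :=
      (intervalIntegral.integral_add_adjacent_intervals (hint le_rfl zero_le_one one_pos)
        (hint zero_le_one hT hT0)).symm
    have hchain : ∫ t in (1 : ℝ)..T, Gs t =
        Φ.φ (WithLp.toLp 2 fun i => ∫ x, ⟪u T x, Φ.g i x⟫) -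
          Φ.φ (WithLp.toLp 2 fun i => ∫ x, ⟪u 1 x, Φ.g i x⟫) :=
      (weakDuality_chainRule hf hu Φ one_pos hT).symm
    have hTi : 0 ≤ T⁻¹ := inv_nonneg.2 hT0.le
    rw [timeMean, hsplit, hchain, abs_mul, abs_of_nonneg hTi, mul_comm]
    refine mul_le_mul_of_nonneg_right ?_ hTi
    refine (abs_add_le _ _).trans (add_le_add le_rfl ((abs_sub _ _).trans (add_le_add ?_ ?_)))
    · rw [← Real.norm_eq_abs]; exact hM₀ _
    · rw [← Real.norm_eq_abs]; exact hM₀ _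
  have hlim : Tendsto (fun T : ℝ => (|I₁| + (M₀ + M₀)) * T⁻¹) atTop (𝓝 0) := by
    simpa using tendsto_inv_atTop_zero.const_mul (|I₁| + (M₀ + M₀))
  refine squeeze_zero_norm' ?_ hlim
  filter_upwards [eventually_ge_atTop (1 : ℝ)] with T hT
  rw [Real.norm_eq_abs]
  exact hbound T hT

end Summit.AnomalousDissipation.AnomalousDissipation.Theorems

end
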